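/-
Copyright (c) 2026 the pub-hodgecm-mathlib formalisation cell (harness21).  Prover seat hodgecm-mathlib-R90-C14-p01 (g0), R90-TF section S8 «ContSpec-n½» (dealer R90-CS-plan (g0),
TWIN-DAG v1 row 5, 2026-09-04T16:18:21Z), h413 = `stmt-HodgeConjecture-24833`: the `U(2,1)` ∕ `(χ₁, χ₂)`-PAIR twin of ★ `K2E1ChiConstantTermColumnsIndependentU2` — LINEAR INDEPENDENCE IN
`𝓗_k(Z_c)` OF THE CONSTANT-TERM COLUMNS `[φ′_j·H^{w}]` for a basis `φ′_j` of PAIR-sections (ruling S8-R10 (b): at `N = 3` the Borel character is a pair, ★ D-S8-3 `IsChiSectionPair`).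
-/
import Summits.HodgeConjecture.HodgeConjecture.Theorems.K2E1ChiConstantTermColumnsIndependentU2   -- ★ (K2E1-p10): rank-generic §1 (`linearIndependent_of_ae_eq_zFun_mul`), §2 (`forall_eq_zero_of_ae_zFun_eq_zero`), χ-free §3 (`continuous_sum_smul`, `exists_borelAdelic_lt_borelHeight_mul_three`)
import Summits.HodgeConjecture.HodgeConjecture.Theorems.K2E1CharacterEisensteinU3PairDefs        -- ★ D-S8-3 p861816 (K2-defs1): `IsChiSectionPair χ₁ χ₂` (+ `.borel_mul`, `.toAdelic_mul`, `.zero`, `.add`, `.smul`), `middleEntryUnitary`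
import HarnessLib

/-!
# h413 ∕ Track B «K2-LIT» ∕ R90-TF S8 — `K2E1ChiConstantTermColumnsIndependentU3`: THE COLUMNS `[φ′_j·H^{w}]` OF THE `(χ₁, χ₂)` CONSTANT-TERM FAMILY OF `U(J₃)` ARE LINEARLY INDEPENDENT IN
# `𝓗_k(Z_c)` — the PAIR-currency twin (TWIN-DAG v1 row 5) of ★ `K2E1ChiConstantTermColumnsIndependentU2`, payer of row 12b∕X1_χ's letter `hLinj` at `N = 3`

Cell `pub/hodgecm-mathlib`, crux h413 = `stmt-HodgeConjecture-24833`, route of record `HCCMUnconditional`; programme R90-TF, section S8 (dealer R90-CS-plan (g0), R90 bus 2026-09-04T16:18:21Z;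
TWIN-DAG v1 `K2/K2E1-p16/g2/TWIN-DAG.v1.K2E1-p16-g2.md` fdfe4481de4f802d, row 5).  Prover seat `hodgecm-mathlib-R90-C14-p01` (g0).  THEOREMS ONLY (no `def`, no `instance`, no notation, no
named-fact hypothesis, no `sorry`); lane `--supports stmt-HodgeConjecture-24833 --as helper` (count-neutral).  Closes no socket.  Generic quadratic datum `(F, E, c)` at `N = 3` in §1–§2; §3 is
the CM print.

WHAT IS NEW AND WHAT IS NOT.  ★ `K2E1ChiConstantTermColumnsIndependentU2` is already rank-generic in everything except the CHARACTER LAW of the sections: its §3–§5 are typed for ★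
`IsChiSection χ φ` (`φ(b g) = χ(b₀₀)·φ(g)`), which at `N = 3` is only the `χ₂ = 1` sub-family of the Borel characters `d(α, β, ᾱ⁻¹) ↦ χ₁(α)·χ₂(β)` of `U(J₃)` («`χ = (φ, ψ)` a unitary
character of `M\𝐌`», [Rogawski1990, §13.9 p. 229]; ruling S8-R10 (b), ★ D-S8-3 `K2E1CharacterEisensteinU3PairDefs.IsChiSectionPair`).  This file re-keys exactly the χ-dependent links to
the PAIR currency: left-`B(F)`-invariance of a pair-section needs `χ₂` AUTOMORPHIC (★ `IsChiSectionPair.toAdelic_mul`: `χ₁` is trivial on principal ideles for free, `χ₂` on the principal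
middle entry `γ₁₁` only when automorphic) — the one new binder `hχ₂ : TorusDict.IsAutomorphic c χ₂`; height raising uses `φ(b g) = χ₁(b₀₀)·χ₂(b₁₁)·φ(g)` with BOTH factors units; and the
`N = 3` torus ray ★ `exists_borelAdelic_lt_borelHeight_mul_three` DISCHARGES `hraise`, which therefore disappears from every signature.  The modulus `δ_B = H²` of `U(J₃)` (vs `H` for
`U(J₂)`) does not enter: the exponent is the free map `w` of the columns (`w z = 2 − z` here, `1 − z` at `N = 2`) and `ρ = HZ^{w} ≠ 0` for every `w`.  Everything else (§1 algebra in
`𝓗_k(Z_c)`, §2 detection on `G(𝔸)`, `continuous_sum_smul`, `lt_pow_mul_borelHeight`) is IMPORTED BY NAME from the ★ `U2` file.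

THE MATHEMATICS (Bernstein–Lapid §4 Claim 2 — non-degeneracy of the constant-term unknown, at a pair `(χ₁, χ₂)`).  A relation `Σ_j c_j α_j = 0` among columns `α_j =ᵐ zFun φ′_j · HZ^{w}` in
`𝓗_k(Z_c)` gives `zFun(Σ_j c_j φ′_j) = 0` a.e. on `Z_c` (★ §1); `φ := Σ_j c_j φ′_j` is a continuous `(χ₁, χ₂)`-section, left-`B(F)`-invariant (`χ₂` automorphic), so ★ §2 detection makes it
vanish on `{c < H}`; the torus ray pushes every `g` above height `c` and `χ₁(b₀₀)χ₂(b₁₁) ≠ 0`, so `φ ≡ 0`, so `c_j = 0` by independence of the `φ′_j`.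
* §1 PAIR-SECTIONS: `ratBorel_mul_of_isChiSectionPair`, `isChiSectionPair_sum_smul`, `eq_zero_of_isChiSectionPair_of_forall_lt_borelHeight`, **`eq_zero_of_ae_zFun_sum_smul_eq_zero_pair`**
  (the detection letter `hdet` paid for pairs).
* §2 HEADS: **`linearIndependent_of_ae_eq_zFun_flatSectionU_pair`**, **`injective_sum_proj_smulRight_of_ae_eq_zFun_flatSectionU_pair`** (★ §4 with `IsChiSectionPair χ₁ χ₂` + `hχ₂`, no `hraise`).
* §3 CM PRINT in row 12b's `hLinj` bytes: **`hLinj_cm_three_pair`** (conclusion = ★ `hLinj_cm_three`'s token-for-token).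
HONEST LABEL: HC_CM is proved only modulo the 7 printed citations (2 remaining named inputs: hLiu418 = `stmt-HodgeConjecture-24832`, h413 = `stmt-HodgeConjecture-24833`) until rung 0
closes; this file asserts no named fact and closes no socket.
References: [BernsteinLapid2019] J. Bernstein, E. Lapid, *On the meromorphic continuation of Eisenstein series*, JAMS 37 (2024), §4 Claim 2 (p. 9), p. 10; [MoeglinWaldspurger1995]
I.2.17, II.1.5, II.1.7; [Rogawski1990] §1.10 p. 9, §13.9 p. 229; [Borel1963] §5.
-/

set_option autoImplicit false
-- the mandated namespace repeats `HodgeConjecture.HodgeConjecture`, as in every `Theorems/*.lean` of this sub-problem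
set_option linter.dupNamespace false

noncomputable section

open MeasureTheory MeasureTheory.Measure Set NumberField IsDedekindDomain Filter Topology Metric
open scoped NNReal ENNReal
open Literature.MeasureTheory.Group Literature.NumberTheory.Automorphic Literature.NumberTheory.Automorphic.UnitaryGroup AdelicGroupData
open Literature.NumberTheory.Automorphic.Arthur2013.Leaves.TECR
open Literature.NumberTheory.GaloisRepresentations (HeckeCharacter)
open Summit.HodgeConjecture.HodgeConjecture.Cruxes.H413.K2E1BorelEisensteinU
open Summit.HodgeConjecture.HodgeConjecture.Cruxes.H413.K2E1BLBorelSpacesU2Defs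
open Summit.HodgeConjecture.HodgeConjecture.Cruxes.H413.K2E1CharacterEisensteinU2Defs (firstEntryUnit)
open Summit.HodgeConjecture.HodgeConjecture.Cruxes.H413.K2E1CharacterEisensteinU3PairDefs (IsChiSectionPair middleEntryUnitary)
open Summit.HodgeConjecture.HodgeConjecture.Cruxes.H413.K2E1BLHeightPowerHolomorphicU2 (borelQuotHeight_pos)
open Summit.HodgeConjecture.HodgeConjecture.Cruxes.H413.K2E1ChiFlatSectionHNHolomorphicU2 (zFun_flatSectionU)
open Summit.HodgeConjecture.HodgeConjecture.Cruxes.H413.K2E1BorelCosetsDictionary (forall_arithmeticBorel_iff)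
open Summit.HodgeConjecture.HodgeConjecture.Cruxes.H413.K2E1BLXSystemPackageFinDimU (injective_sum_proj_smulRight_iff)
open Summit.HodgeConjecture.HodgeConjecture.Cruxes.H413.K2E1ChiConstantTermColumnsIndependentU2

namespace Summit.HodgeConjecture.HodgeConjecture.Cruxes.H413.K2E1ChiConstantTermColumnsIndependentU3

/-! ## §1 `(χ₁, χ₂)`-sections of `U(J₃)`: left-`B(F)`-invariance, finite sums, height raising, and the detection letter paid -/

section PairSections

variable {F E : Type} [Field F] [NumberField F] [Field E] [NumberField E] [Algebra F E] {c : E ≃ₐ[F] E}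
  {χ₁ : HeckeCharacter E} {χ₂ : ↥(TorusDict.torus c) →ₜ* ℂˣ}

/-- A `(χ₁, χ₂)`-section with AUTOMORPHIC `χ₂` is left-`B(F)`-invariant in the `ratBorelSubgroup` spelling of the BL leaf (★ `IsChiSectionPair.toAdelic_mul` through ★ `forall_arithmeticBorel_iff`).
[cite: MoeglinWaldspurger1995, II.1.5] -/
theorem ratBorel_mul_of_isChiSectionPair {φ : (quasiSplit F E c 3).Adelic → ℂ} (hφ : IsChiSectionPair χ₁ χ₂ φ) (hχ₂ : TorusDict.IsAutomorphic c χ₂) :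
    ∀ γ ∈ ratBorelSubgroup F E c 3, ∀ g : (quasiSplit F E c 3).Adelic, φ (γ * g) = φ g := fun γ hγ g =>
  (forall_arithmeticBorel_iff.2 (hφ.toAdelic_mul hχ₂)) ⟨γ, ratBorelSubgroup_le_arithmeticSubgroup F E c 3 hγ⟩ ((mem_arithmeticBorel_iff _).2 hγ.1) g

/-- Finite linear combinations of `(χ₁, χ₂)`-sections are `(χ₁, χ₂)`-sections. [folklore] -/
theorem isChiSectionPair_sum_smul {ι' : Type*} (s : Finset ι') (cj : ι' → ℂ) {φ' : ι' → (quasiSplit F E c 3).Adelic → ℂ} (hφχ : ∀ j, IsChiSectionPair χ₁ χ₂ (φ' j)) :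
    IsChiSectionPair χ₁ χ₂ (∑ j ∈ s, cj j • φ' j) :=
  Finset.sum_induction _ (fun ψ => IsChiSectionPair χ₁ χ₂ ψ) (fun _ _ ha hb => ha.add hb) (IsChiSectionPair.zero χ₁ χ₂) fun j _ => (hφχ j).smul (cj j)

/-- **HEIGHT RAISING FOR PAIR-SECTIONS OF `U(J₃)`**: a `(χ₁, χ₂)`-section vanishing on `{c < H}` vanishes identically — every point is pushed above height `c` by a torus element (★
`exists_borelAdelic_lt_borelHeight_mul_three`, the `N = 3` torus ray `H(t_r g) = r^{[E:ℚ]} H(g)`), and `φ(b g) = χ₁(b₀₀)·χ₂(b₁₁)·φ(g)` with both factors units. [cite: MoeglinWaldspurger1995, I.2.17]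
[cite: BernsteinLapid2019, §4 Claim 2 (p. 9)] -/
theorem eq_zero_of_isChiSectionPair_of_forall_lt_borelHeight {φ : (quasiSplit F E c 3).Adelic → ℂ} (hφ : IsChiSectionPair χ₁ χ₂ φ) {c₁ : ℝ≥0}
    (h : ∀ g : (quasiSplit F E c 3).Adelic, c₁ < borelHeight g → φ g = 0) : φ = 0 := by
  funext g
  obtain ⟨b, hb, hlt⟩ := exists_borelAdelic_lt_borelHeight_mul_three c₁ g
  have h1 := h (b * g) hlt
  rw [hφ.borel_mul hb g] at h1
  exact (mul_eq_zero.1 h1).resolve_left (mul_ne_zero (Units.ne_zero _) (Units.ne_zero _))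

variable [MeasurableSpace (quasiSplit F E c 3).Adelic] [BorelSpace (quasiSplit F E c 3).Adelic]

/-- **THE DETECTION LETTER `hdet` PAID FOR PAIR-SECTIONS**: for linearly independent CONTINUOUS `(χ₁, χ₂)`-sections `φ′_j` with `χ₂` automorphic, in the comparison frame `(ν_G, β, μZ)` (`ν_G`
left-invariant and positive on opens), a linear combination `Σ_j c_j φ′_j` whose descent vanishes `μZ`-a.e. on `Z_c` is trivial: ★ §2 detection on `{c < H}`, height raising, independence.
[cite: BernsteinLapid2019, §4 Claim 2 (p. 9)] [cite: MoeglinWaldspurger1995, I.2.17] -/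
theorem eq_zero_of_ae_zFun_sum_smul_eq_zero_pair (νG : Measure (quasiSplit F E c 3).Adelic) [νG.IsMulLeftInvariant] [νG.IsOpenPosMeasure]
    {β : (quasiSplit F E c 3).Adelic → ℝ≥0∞} (hβ : IsCoveringWeight ↥((arithmeticBorel F E c 3).map (quasiSplit F E c 3).arithmeticSubgroup.subtype) β)
    {μZ : Measure (borelQuotient F E c 3)}
    (hμZ : ∀ f : borelQuotient F E c 3 → ℝ≥0∞, Measurable f → ∫⁻ z, f z ∂μZ = ∫⁻ g, β g * f (toBorelQuotient F E c 3 g) ∂νG)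
    {ι' : Type*} [Fintype ι'] {φ' : ι' → (quasiSplit F E c 3).Adelic → ℂ} (hli : LinearIndependent ℂ φ') (hφc : ∀ j, Continuous (φ' j))
    (hφχ : ∀ j, IsChiSectionPair χ₁ χ₂ (φ' j)) (hχ₂ : TorusDict.IsAutomorphic c χ₂) {c₁ : ℝ≥0} {cj : ι' → ℂ}
    (h0 : ∀ᵐ x ∂(μZ.restrict {x | c₁ < borelQuotHeight F E c 3 x}), zFun F E c 3 (∑ j, cj j • φ' j) x = 0) : cj = 0 := by
  have hχ : IsChiSectionPair χ₁ χ₂ (∑ j, cj j • φ' j) := isChiSectionPair_sum_smul Finset.univ cj hφχ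
  have hzero := forall_eq_zero_of_ae_zFun_eq_zero νG hβ hμZ (continuous_sum_smul Finset.univ cj hφc) (ratBorel_mul_of_isChiSectionPair hχ hχ₂) h0
  have hφ0 : ∑ j, cj j • φ' j = 0 := eq_zero_of_isChiSectionPair_of_forall_lt_borelHeight hχ hzero
  funext j
  exact Fintype.linearIndependent_iff.1 hli cj hφ0 j

/-! ## §2 The heads: linear independence of the columns `[φ′_j·H^{w}]` in `𝓗_k(Z_c)` and injectivity of `L = Σ_j proj_j.smulRight α_j`, pair currency -/

/-- **THE COLUMNS `α_j =ᵐ zFun (f^{φ′_j}_{w}) = zFun φ′_j · HZ^{w}` ARE LINEARLY INDEPENDENT IN `𝓗_k(Z_c)`** for linearly independent continuous `(χ₁, χ₂)`-sections `φ′_j` of `U(J₃)` with `χ₂`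
automorphic (comparison frame `(ν_G, β, μZ)`; no `hraise` — the `N = 3` torus ray is ★): ★ §1 on the §1-paid detection letter, with `ρ = HZ^{w} ≠ 0` (any `w`, e.g. `2 − z`).
[cite: BernsteinLapid2019, §4 Claim 2 (p. 9)] [cite: MoeglinWaldspurger1995, II.1.7] -/
theorem linearIndependent_of_ae_eq_zFun_flatSectionU_pair (νG : Measure (quasiSplit F E c 3).Adelic) [νG.IsMulLeftInvariant] [νG.IsOpenPosMeasure]
    {β : (quasiSplit F E c 3).Adelic → ℝ≥0∞} (hβ : IsCoveringWeight ↥((arithmeticBorel F E c 3).map (quasiSplit F E c 3).arithmeticSubgroup.subtype) β)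
    {μZ : Measure (borelQuotient F E c 3)}
    (hμZ : ∀ f : borelQuotient F E c 3 → ℝ≥0∞, Measurable f → ∫⁻ z, f z ∂μZ = ∫⁻ g, β g * f (toBorelQuotient F E c 3 g) ∂νG)
    {ι' : Type*} [Fintype ι'] {φ' : ι' → (quasiSplit F E c 3).Adelic → ℂ} (hli : LinearIndependent ℂ φ') (hφc : ∀ j, Continuous (φ' j))
    (hφχ : ∀ j, IsChiSectionPair χ₁ χ₂ (φ' j)) (hχ₂ : TorusDict.IsAutomorphic c χ₂)
    {k : ℕ} {c₁ : ℝ≥0} {α : ι' → HN F E c 3 k c₁ μZ} {w : ℂ} (hα : ∀ j, (α j : borelQuotient F E c 3 → ℂ) =ᵐ[weightedTruncMeasure F E c 3 k c₁ μZ] zFun F E c 3 (flatSectionU (φ' j) w)) :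
    LinearIndependent ℂ α := by
  refine linearIndependent_of_ae_eq_zFun_mul (φ' := φ') (ρ := fun x => (((borelQuotHeight F E c 3 x : ℝ≥0) : ℝ) : ℂ) ^ w) (fun x h => ?_) (fun j => ?_)
    fun cj h0 => eq_zero_of_ae_zFun_sum_smul_eq_zero_pair νG hβ hμZ hli hφc hφχ hχ₂ h0
  · exact (NNReal.coe_pos.2 (borelQuotHeight_pos x)).ne' (Complex.ofReal_eq_zero.1 ((Complex.cpow_eq_zero_iff _ _).1 h).1)
  · show (α j : borelQuotient F E c 3 → ℂ) =ᵐ[weightedTruncMeasure F E c 3 k c₁ μZ] fun x => zFun F E c 3 (φ' j) x * (((borelQuotHeight F E c 3 x : ℝ≥0) : ℝ) : ℂ) ^ w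
    rw [← zFun_flatSectionU]; exact hα j

/-- **`L = Σ_j proj_j.smulRight α_j : ℂ^ι →L 𝓗_k(Z_c)` IS INJECTIVE** when `α_j =ᵐ zFun (f^{φ′_j}_{w})` for linearly independent continuous `(χ₁, χ₂)`-sections `φ′_j` of `U(J₃)`, `χ₂`
automorphic (★ 11b `injective_sum_proj_smulRight_iff`) — the content of row 12b's letter `hLinj` at one point `z`, pair currency. [cite: BernsteinLapid2019, §4 Claim 2 (p. 9)] -/
theorem injective_sum_proj_smulRight_of_ae_eq_zFun_flatSectionU_pair (νG : Measure (quasiSplit F E c 3).Adelic) [νG.IsMulLeftInvariant] [νG.IsOpenPosMeasure]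
    {β : (quasiSplit F E c 3).Adelic → ℝ≥0∞} (hβ : IsCoveringWeight ↥((arithmeticBorel F E c 3).map (quasiSplit F E c 3).arithmeticSubgroup.subtype) β)
    {μZ : Measure (borelQuotient F E c 3)}
    (hμZ : ∀ f : borelQuotient F E c 3 → ℝ≥0∞, Measurable f → ∫⁻ z, f z ∂μZ = ∫⁻ g, β g * f (toBorelQuotient F E c 3 g) ∂νG)
    {ι' : Type*} [Fintype ι'] {φ' : ι' → (quasiSplit F E c 3).Adelic → ℂ} (hli : LinearIndependent ℂ φ') (hφc : ∀ j, Continuous (φ' j))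
    (hφχ : ∀ j, IsChiSectionPair χ₁ χ₂ (φ' j)) (hχ₂ : TorusDict.IsAutomorphic c χ₂)
    {k : ℕ} {c₁ : ℝ≥0} {α : ι' → HN F E c 3 k c₁ μZ} {w : ℂ} (hα : ∀ j, (α j : borelQuotient F E c 3 → ℂ) =ᵐ[weightedTruncMeasure F E c 3 k c₁ μZ] zFun F E c 3 (flatSectionU (φ' j) w)) :
    Function.Injective ((∑ j, (ContinuousLinearMap.proj (R := ℂ) (φ := fun _ : ι' => ℂ) j).smulRight (α j) : (ι' → ℂ) →L[ℂ] HN F E c 3 k c₁ μZ) : (ι' → ℂ) → HN F E c 3 k c₁ μZ) :=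
  (injective_sum_proj_smulRight_iff (fun j (_ : ℂ) => α j) 0).2 (linearIndependent_of_ae_eq_zFun_flatSectionU_pair νG hβ hμZ hli hφc hφχ hχ₂ hα)

end PairSections

/-! ## §3 The CM print (`N = 3`, pair currency) in the bytes of row 12b's `hLinj` -/

section CM

variable (L : Type) [Field L] [NumberField L] [IsCMField L]

/-- **ROW 12b's `hLinj` FOR THE CM PAIR `(L⁺, L)` AT `N = 3`, PAIR CURRENCY**: for a Haar measure `ν_G` of `U(J₃)(𝔸_{L⁺})`, a covering weight `β` of `B(F)♯` with comparison `hμZ`, linearly independent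
continuous `(χ₁, χ₂)`-sections `φ′_j` (`χ₁` a Hecke character of `L`, `χ₂` an AUTOMORPHIC character of the `U(1)`-torus), and columns `α_j(z) =ᵐ zFun (f^{φ′_j}_{w(z)})` on `Z_a` along the
Godement part of the ball (any exponent map `w`, e.g. `w z = 2 − z`), the coordinate family `L(z) = Σ_j proj_j.smulRight (α_j z)` is injective there — conclusion = ★ `hLinj_cm_three`'s
token-for-token. [cite: BernsteinLapid2019, §4 Claim 2 (p. 9)] [cite: MoeglinWaldspurger1995, II.1.7] [cite: Rogawski1990, §13.9 p. 229] -/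
theorem hLinj_cm_three_pair [MeasurableSpace (quasiSplit (↥(maximalRealSubfield L)) L (IsCMField.complexConj L) 3).Adelic] [BorelSpace (quasiSplit (↥(maximalRealSubfield L)) L (IsCMField.complexConj L) 3).Adelic]
    (νG : Measure (quasiSplit (↥(maximalRealSubfield L)) L (IsCMField.complexConj L) 3).Adelic) [νG.IsHaarMeasure]
    {β : (quasiSplit (↥(maximalRealSubfield L)) L (IsCMField.complexConj L) 3).Adelic → ℝ≥0∞}
    (hβ : IsCoveringWeight ↥((arithmeticBorel (↥(maximalRealSubfield L)) L (IsCMField.complexConj L) 3).map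
      (quasiSplit (↥(maximalRealSubfield L)) L (IsCMField.complexConj L) 3).arithmeticSubgroup.subtype) β)
    {μZ : Measure (borelQuotient (↥(maximalRealSubfield L)) L (IsCMField.complexConj L) 3)}
    (hμZ : ∀ f : borelQuotient (↥(maximalRealSubfield L)) L (IsCMField.complexConj L) 3 → ℝ≥0∞, Measurable f →
      ∫⁻ z, f z ∂μZ = ∫⁻ g, β g * f (toBorelQuotient (↥(maximalRealSubfield L)) L (IsCMField.complexConj L) 3 g) ∂νG)
    {χ₁ : HeckeCharacter L} {χ₂ : ↥(TorusDict.torus (IsCMField.complexConj L)) →ₜ* ℂˣ} (hχ₂ : TorusDict.IsAutomorphic (IsCMField.complexConj L) χ₂)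
    {ι' : Type*} [Fintype ι'] {φ' : ι' → (quasiSplit (↥(maximalRealSubfield L)) L (IsCMField.complexConj L) 3).Adelic → ℂ}
    (hli : LinearIndependent ℂ φ') (hφc : ∀ j, Continuous (φ' j)) (hφχ : ∀ j, IsChiSectionPair χ₁ χ₂ (φ' j)) (σ₀ : ℝ) (n k : ℕ) {a : ℝ≥0} (w : ℂ → ℂ)
    {α : ι' → ℂ → HN (↥(maximalRealSubfield L)) L (IsCMField.complexConj L) 3 k a μZ}
    (hα : ∀ j, ∀ z ∈ ball (0 : ℂ) (n + 2), σ₀ < z.re → (α j z : borelQuotient (↥(maximalRealSubfield L)) L (IsCMField.complexConj L) 3 → ℂ)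
      =ᵐ[weightedTruncMeasure (↥(maximalRealSubfield L)) L (IsCMField.complexConj L) 3 k a μZ] zFun (↥(maximalRealSubfield L)) L (IsCMField.complexConj L) 3 (flatSectionU (φ' j) (w z))) :
    ∀ z ∈ ball (0 : ℂ) (n + 2), σ₀ < z.re →
      Function.Injective ((∑ j, (ContinuousLinearMap.proj (R := ℂ) (φ := fun _ : ι' => ℂ) j).smulRight (α j z) :
        (ι' → ℂ) →L[ℂ] HN (↥(maximalRealSubfield L)) L (IsCMField.complexConj L) 3 k a μZ) : (ι' → ℂ) → HN (↥(maximalRealSubfield L)) L (IsCMField.complexConj L) 3 k a μZ) :=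
  fun z hz hσ => injective_sum_proj_smulRight_of_ae_eq_zFun_flatSectionU_pair νG hβ hμZ hli hφc hφχ hχ₂ fun j => hα j z hz hσ

end CM

end Summit.HodgeConjecture.HodgeConjecture.Cruxes.H413.K2E1ChiConstantTermColumnsIndependentU3

end
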